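import Literature.AlgebraicGeometry.AbelianSchemes.SerreTwistPolarization
import Literature.AlgebraicGeometry.AbelianSchemes.SerreTensorIdealTranslationBaseChange
import Literature.AlgebraicGeometry.AbelianSchemes.AbelianSchemeOverLevelBaseChange
import Literature.AlgebraicGeometry.AbelianSchemes.AbelianSchemePolarizationBaseChange
import Literature.AlgebraicGeometry.AbelianSchemes.DualIsogenyBaseChange
import Literature.AlgebraicGeometry.AbelianSchemes.PoincareSheafMulN
import HarnessLib

/-!
# Base change of the Serre-twisted polarization and level structure ([MumfordFogartyKirwan1994] Def. 7.2;
# [RapoportSmithlingZhang2020Diagonal] §3.2, (4.23); [Conrad2004GrossZagier] §7)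

Topic `AlgebraicGeometry/AbelianSchemes`, namespace `Literature.AlgebraicGeometry.AbelianSchemes.AbelianSchemeOver`.
THEOREMS ONLY (no definition, no named fact, no `instance`, no notation, no `sorry`); ANY base change `g : S′ → S`.
Cell `hodgecm-mathlib`, F0/P6 «MOD», organ deal (O-γ) «SERRE TWIST OF A PEL FAMILY», part (γ4) «BASE CHANGE» (desk F0P6a-plan (g1)
2026-09-01T18:10:45Z; lead hand A-p06 (g30), twins A-p01 (g24), F0P6-p16 (g0)); over ★ `SerreTwistPolarization` (γ2, p846320), the level
relation of ★ `SerreTwistLevel` (γ3; this file does not import it — only the defining equation `lvl′.σ i = lvl.σ i ≫ ψ_P` is used), ★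
`SerreTensorIdealTranslationBaseChange` (`(ψ_P)_{S′} ≫ β = ψ_P(A_{S′})`) and ★ `DualIsogenyBaseChange` (`(ψ^∨)_{S′} = (ψ_{S′})^∨`).
`--supports stmt-HodgeConjecture-24832`, count-neutral: HC_CM is proved only modulo the 2 remaining named inputs (hLiu418, h413) until rung 0
closes; this file discharges none of them.

## Mathematics

[MumfordFogartyKirwan1994, Ch. 7 §2 Def. 7.2]: the moduli data pull back «in the obvious way», `(X, λ, σᵢ) ↦ (X ×_S T, λ_T, σᵢ ×_S T)`.
For the Serre twist `A ⊗_𝒪 𝔟` of `(A, ι, λ, (σᵢ))` along the ideal translation `ψ_P : A → A ⊗_𝒪 𝔟` with quasi-inverse `ψ′` (★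
`serreTranslate`, ★ `serreTranslateInv`) every defining relation of the twisted data is an equation between composites of homomorphisms,
multiplications `[c]` and dual homomorphisms `(·)^∨`; base change `×_S S′` is a functor (`Over.pullback g`) commuting with `[c]` (★
`baseChangeHom_mulN`) and with `(·)^∨` relative to the base-changed dual pairs (★ `dualIsogeny_baseChange_eq_lift`), so:

* §1 (generic) `sectionBaseChange_comp` (`(τ ≫ u) ×_S S′ = (τ ×_S S′) ≫ u_{S′}`), `LevelStructure.baseChange_σ_eq_comp_of_σ_eq_comp` (the
  relation «`lvl′.σ i = lvl.σ i ≫ u`» base-changes), `baseChangeHom_comp_eq_pow_id_of_comp_eq_pow_id` (a quasi-inverse pair base-changes to a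
  quasi-inverse pair), `DualPair.baseChangeHom_dualIsogenyOver_base` (`(ψ^∨)_{S′} = (ψ_{S′})^∨` in `Over S′`, any `g` — the field-point case is ★
  `DualPair.baseChangeHom_dualIsogenyOver`), `DualPair.baseChangeHom_similitude_base` (`ψ ≫ λ_B ≫ ψ^∨ = λ_A ≫ [c]` base-changes);
* §2 (the twist, in the `β`-free currency `(A ⊗_𝒪 𝔟) ×_S S′`) **`baseChangeHom_serreTwistLamPull`** (`(λ^{pull})_{S′} = ψ′_{S′} ≫ λ_{S′} ≫ (ψ′_{S′})^∨`),
  **`IsExactTwistPol.baseChange`** (`ψ_P ≫ λ′ ≫ ψ_P^∨ = λ ≫ [c]` ⟹ the same for `(ψ_P)_{S′}`, `λ′_{S′}`, `λ_{S′}`), **`LevelStructure.baseChange_σ_serreTwist`**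
  (`lvl′.σ i = lvl.σ i ≫ ψ_P` ⟹ `(lvl′ ×_S S′).σ i = (lvl ×_S S′).σ i ≫ (ψ_P)_{S′}`);
* §3 (the bridge to the Serre twist OF the base change, `β : (A ⊗_𝒪 𝔟)_{S′} ≅ A_{S′} ⊗_𝒪 𝔟`, ★ `serreTensorBaseChangeIso′`)
  **`LevelStructure.baseChange_σ_serreTwist_comp_baseChangeIso`**: `(lvl′ ×_S S′).σ i ≫ β = (lvl ×_S S′).σ i ≫ ψ_P(A_{S′})` — the base change of
  the twisted level structure, carried along `β`, satisfies the defining relation of the twisted level structure of `(A_{S′}, ι_{S′}, lvl ×_S S′)`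
  (so equals it by ★ `SerreTwistLevel`'s uniqueness once transported, ★ `LevelStructureTransportIso`).

So fibres ∕ special fibres of the twisted family carry the twists of the fibre data ([RapoportSmithlingZhang2020Diagonal] §3.2: the Serre
construction is compatible with base change; [Conrad2004GrossZagier] §7 Thm. 7.5).

## References
* [MumfordFogartyKirwan1994] D. Mumford, J. Fogarty, F. Kirwan, *Geometric Invariant Theory*, 3rd ed. (1994), Ch. 6 §1 Cor. 6.8 (p. 118), Ch. 7 §2 Def. 7.2 (p. 129).
* [RapoportSmithlingZhang2020Diagonal] M. Rapoport, B. Smithling, W. Zhang, *Arithmetic diagonal cycles on unitary Shimura varieties*, Compositio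
  Math. 156 (2020), §3.2, (4.23).
* [Conrad2004GrossZagier] B. Conrad, *Gross–Zagier revisited*, MSRI Publ. 49 (2004), §7 Thm. 7.5.
* [GortzWedhorn2020] U. Görtz, T. Wedhorn, *Algebraic Geometry I*, 2nd ed. (2020), Section (4.7), (4.7.1) (p. 108).
* Tree: ★ `SerreTwistPolarization`, ★ `SerreTensorIdealTranslationBaseChange`, ★ `AbelianSchemeOverLevelBaseChange`, ★ `AbelianSchemePolarizationBaseChange`,
  ★ `DualIsogenyBaseChange`, ★ `PoincareSheafMulN`.
-/

noncomputable section

universe u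

open CategoryTheory CategoryTheory.Limits AlgebraicGeometry MonoidalCategory CartesianMonoidalCategory
open scoped MonObj

namespace Literature.AlgebraicGeometry.AbelianSchemes

namespace AbelianSchemeOver

set_option backward.isDefEq.respectTransparency false

variable {S S' : Scheme.{u}} (g : S' ⟶ S) {A B : AbelianSchemeOver S}

/-! ### §1 Generic base-change bookkeeping -/

/-- **`(τ ≫ u) ×_S S′ = (τ ×_S S′) ≫ u_{S′}`**: pull-back of sections commutes with composition by a morphism `u : A → B`
(functoriality of `Over.pullback g`). [cite: MumfordFogartyKirwan1994, Ch. 7 §2 Definition 7.2 (p. 129)] -/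
theorem sectionBaseChange_comp (τ : A.Sections) (u : A.X ⟶ B.X) :
    B.sectionBaseChange g (τ ≫ u) = A.sectionBaseChange g τ ≫ baseChangeHom u g := by
  rw [sectionBaseChange_apply, sectionBaseChange_apply, Functor.map_comp, Category.assoc]

/-- **The relation «`lvl′.σ i = lvl.σ i ≫ u`» base-changes**: `(lvl′ ×_S S′).σ i = (lvl ×_S S′).σ i ≫ u_{S′}` (★ `LevelStructure.baseChange_σ`).
[cite: MumfordFogartyKirwan1994, Ch. 7 §2 Definition 7.2 (p. 129)] -/
theorem LevelStructure.baseChange_σ_eq_comp_of_σ_eq_comp {g₀ n : ℕ} {lvl : A.LevelStructure g₀ n} {lvl' : B.LevelStructure g₀ n}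
    {u : A.X ⟶ B.X} (h : ∀ i, lvl'.σ i = lvl.σ i ≫ u) (i : Fin g₀ ⊕ Fin g₀) :
    (lvl'.baseChange g).σ i = (lvl.baseChange g).σ i ≫ baseChangeHom u g := by
  rw [LevelStructure.baseChange_σ, LevelStructure.baseChange_σ, h i, sectionBaseChange_comp]

/-- **A quasi-inverse pair base-changes to a quasi-inverse pair**: `φ ≫ ψ = [N]_A ⟹ φ_{S′} ≫ ψ_{S′} = [N]_{A_{S′}}` (★ `baseChangeHom_mulN`).
[cite: GortzWedhorn2020, Section (4.7), (4.7.1) (p. 108)] [cite: MumfordAV1970, §7 Thm. 4 (p. 72)] -/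
theorem baseChangeHom_comp_eq_pow_id_of_comp_eq_pow_id (φ : A.X ⟶ B.X) (ψ : B.X ⟶ A.X) {N : ℕ} (h : φ ≫ ψ = (𝟙 A.X) ^ N) :
    baseChangeHom φ g ≫ baseChangeHom ψ g = (𝟙 (A.baseChange g).X) ^ N := by
  rw [← mulN_def, ← A.baseChangeHom_mulN g N, mulN_def, ← h]
  exact ((Over.pullback g).map_comp φ ψ).symm

namespace DualPair

variable (ψ : A.X ⟶ B.X) [IsMonHom ψ] (D' : A.DualPair) (DB : B.DualPair)

/-- **`(ψ^∨) ×_S S′ = (ψ ×_S S′)^∨`** in `Over S′`, for ANY base change `g : S′ → S` (★ `dualIsogeny_baseChange_eq_lift`; the field-point case is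
★ `baseChangeHom_dualIsogenyOver`). [cite: MumfordFogartyKirwan1994, Ch. 6 §1 Cor. 6.8 (p. 118)] [cite: MumfordAV1970, §15 Thm. 1 (p. 143)] -/
theorem baseChangeHom_dualIsogenyOver_base :
    baseChangeHom (A := DB.hat) (B := D'.hat) (dualIsogenyOver ψ D' DB) g =
      @dualIsogenyOver _ (A.baseChange g) (B.baseChange g) (baseChangeHom ψ g) (isMonHom_baseChangeHom ψ g)
        (D'.baseChange g) (DB.baseChange g) := by
  apply Over.OverMorphism.ext
  rw [dualIsogenyOver_left]
  apply pullback.hom_ext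
  · rw [dualIsogeny_baseChange_comp_fst, baseChangeHom_left_comp_fst, dualIsogenyOver_left]
  · rw [dualIsogeny_baseChange_comp_snd]
    exact Over.w (baseChangeHom (A := DB.hat) (B := D'.hat) (dualIsogenyOver ψ D' DB) g)

/-- **The similitude relation base-changes**: `ψ ≫ λ_B ≫ ψ^∨ = λ_A ≫ [c]_{Â}` over `S` gives
`ψ_{S′} ≫ (λ_B)_{S′} ≫ (ψ_{S′})^∨ = (λ_A)_{S′} ≫ [c]_{Â_{S′}}` over `S′` (any `g`; the field-point case is ★ `baseChangeHom_similitude`).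
[cite: MumfordFogartyKirwan1994, Ch. 6 §1 Cor. 6.8 (p. 118) and Ch. 7 §2 Definition 7.2 (p. 129)] -/
theorem baseChangeHom_similitude_base (lamA : A.X ⟶ D'.hat.X) (lamB : B.X ⟶ DB.hat.X) (c : ℕ)
    (h : ψ ≫ lamB ≫ dualIsogenyOver ψ D' DB = lamA ≫ D'.hat.mulN c) :
    baseChangeHom ψ g ≫ baseChangeHom lamB g ≫
        @dualIsogenyOver _ (A.baseChange g) (B.baseChange g) (baseChangeHom ψ g) (isMonHom_baseChangeHom ψ g)
          (D'.baseChange g) (DB.baseChange g) =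
      baseChangeHom lamA g ≫ (D'.baseChange g).hat.mulN c := by
  rw [← baseChangeHom_dualIsogenyOver_base g ψ D' DB]
  have h' := congrArg (fun f => (Over.pullback g).map f) h
  simp only [Functor.map_comp] at h'
  rw [show (Over.pullback g).map (D'.hat.mulN c) = (D'.baseChange g).hat.mulN c from D'.hat.baseChangeHom_mulN g c] at h'
  exact h'

end DualPair

/-! ### §2 The Serre twist: base change of `λ^{pull}`, of the exactness relation, of the level relation -/

section Serre

variable {O : Type*} [CommRing O] (act : A.RingAction O) [IsCommMonObj A.X] {m : ℕ} (E' : Matrix (Fin m) (Fin m) O)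
  (hE' : E' * E' = E') (P : Matrix (Fin m) (Fin 1) O) (Q : Matrix (Fin 1) (Fin m) O)
  (D : A.DualPair) (Db : (serreTensor act E' hE').DualPair) (pol : A.Polarization D)

/-- **`(λ^{pull})_{S′} = ψ′_{S′} ≫ λ_{S′} ≫ (ψ′_{S′})^∨`**: the base change of the pulled-back twisted polarization ★ `serreTwistLamPull` is the
same composite formed from the base-changed homomorphisms and dual pairs. [cite: MumfordFogartyKirwan1994, Ch. 7 §2 Definition 7.2 (p. 129)]
[cite: RapoportSmithlingZhang2020Diagonal, §3.2 and (4.23)] -/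
theorem baseChangeHom_serreTwistLamPull :
    baseChangeHom (serreTwistLamPull act E' hE' Q D Db pol) g =
      baseChangeHom (serreTranslateInv act E' hE' Q) g ≫ (pol.baseChange g).lam ≫
        @DualPair.dualIsogenyOver _ ((serreTensor act E' hE').baseChange g) (A.baseChange g)
          (baseChangeHom (serreTranslateInv act E' hE' Q) g)
          (@isMonHom_baseChangeHom _ _ _ _ (serreTranslateInv act E' hE' Q) g (isMonHom_serreTranslateInv act E' hE' Q))
          (Db.baseChange g) (D.baseChange g) := by
  haveI := isMonHom_serreTranslateInv act E' hE' Q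
  rw [serreTwistLamPull_def, ← DualPair.baseChangeHom_dualIsogenyOver_base g (serreTranslateInv act E' hE' Q) Db D,
    Polarization.baseChange_lam]
  exact ((Over.pullback g).map_comp _ _).trans (by rw [Functor.map_comp])

/-- **THE EXACTNESS RELATION BASE-CHANGES**: if `ψ_P ≫ λ′ ≫ ψ_P^∨ = λ ≫ [c]_{Â}` over `S` (★ `IsExactTwistPol … c λ′`) then
`(ψ_P)_{S′} ≫ λ′_{S′} ≫ ((ψ_P)_{S′})^∨ = λ_{S′} ≫ [c]_{Â_{S′}}` over `S′` (with the base-changed dual pairs `D ×_S S′`, `D_𝔟 ×_S S′`).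
[cite: MumfordFogartyKirwan1994, Ch. 7 §2 Definition 7.2 (p. 129)] [cite: RapoportSmithlingZhang2020Diagonal, §3.2 and (4.23)] -/
theorem IsExactTwistPol.baseChange {c : ℕ} {lam' : (serreTensor act E' hE').X ⟶ Db.hat.X}
    (h : IsExactTwistPol act E' hE' P D Db pol c lam') :
    baseChangeHom (serreTranslate act E' hE' P) g ≫ baseChangeHom lam' g ≫
        @DualPair.dualIsogenyOver _ (A.baseChange g) ((serreTensor act E' hE').baseChange g)
          (baseChangeHom (serreTranslate act E' hE' P) g)
          (@isMonHom_baseChangeHom _ _ _ _ (serreTranslate act E' hE' P) g (isMonHom_serreTranslate act E' hE' P))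
          (D.baseChange g) (Db.baseChange g) =
      (pol.baseChange g).lam ≫ (D.baseChange g).hat.mulN c := by
  haveI := isMonHom_serreTranslate act E' hE' P
  rw [Polarization.baseChange_lam]
  exact DualPair.baseChangeHom_similitude_base g (serreTranslate act E' hE' P) D Db pol.lam lam' c h

/-- **THE TWISTED LEVEL RELATION BASE-CHANGES**: `lvl′.σ i = lvl.σ i ≫ ψ_P ⟹ (lvl′ ×_S S′).σ i = (lvl ×_S S′).σ i ≫ (ψ_P)_{S′}`.
[cite: MumfordFogartyKirwan1994, Ch. 7 §2 Definition 7.2 (p. 129)] [cite: RapoportSmithlingZhang2020Diagonal, §3.2 and (4.23)] -/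
theorem LevelStructure.baseChange_σ_serreTwist {g₀ n : ℕ} {lvl : A.LevelStructure g₀ n}
    {lvl' : (serreTensor act E' hE').LevelStructure g₀ n} (h : ∀ i, lvl'.σ i = lvl.σ i ≫ serreTranslate act E' hE' P)
    (i : Fin g₀ ⊕ Fin g₀) :
    (lvl'.baseChange g).σ i = (lvl.baseChange g).σ i ≫ baseChangeHom (serreTranslate act E' hE' P) g :=
  LevelStructure.baseChange_σ_eq_comp_of_σ_eq_comp g h i

/-! ### §3 The bridge to the Serre twist of the base change along `β : (A ⊗_𝒪 𝔟)_{S′} ≅ A_{S′} ⊗_𝒪 𝔟` -/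

/-- **`(lvl′ ×_S S′).σ i ≫ β = (lvl ×_S S′).σ i ≫ ψ_P(A_{S′})`**: carried along the base-change isomorphism ★ `serreTensorBaseChangeIso′`, the
base change of the twisted level structure satisfies the defining relation of the twisted level structure of the base change
(★ `serreTranslateBC_comp_baseChangeIso`: `(ψ_P)_{S′} ≫ β = ψ_P(A_{S′})`).
[cite: MumfordFogartyKirwan1994, Ch. 7 §2 Definition 7.2 (p. 129)] [cite: Conrad2004GrossZagier, §7 (Thm. 7.5)] -/
theorem LevelStructure.baseChange_σ_serreTwist_comp_baseChangeIso {g₀ n : ℕ} {lvl : A.LevelStructure g₀ n}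
    {lvl' : (serreTensor act E' hE').LevelStructure g₀ n} (h : ∀ i, lvl'.σ i = lvl.σ i ≫ serreTranslate act E' hE' P)
    (hP : E' * P = P) (i : Fin g₀ ⊕ Fin g₀) :
    (lvl'.baseChange g).σ i ≫ (serreTensorBaseChangeIso' g act E' hE').hom =
      (lvl.baseChange g).σ i ≫
        @serreTranslate S' (A.baseChange g) O _ (act.baseChange g) (isCommMonObj_baseChange g) m E' hE' P := by
  rw [LevelStructure.baseChange_σ_serreTwist g act E' hE' P h i, Category.assoc,
    ← serreTranslateBC_comp_baseChangeIso g act P E' hE' hP]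
  rfl

end Serre

end AbelianSchemeOver

end Literature.AlgebraicGeometry.AbelianSchemes

end
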